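import Summits.CriticalPhenomena.SAWScalingLimit.Theorems.FKGToTraversalBound.Negative.DeepEndpointGap
import Summits.CriticalPhenomena.SAWScalingLimit.Theorems.SAWLeftRightFKGLeftRightFKGStubStepMonotoneAux2
import Literature.Probability.Percolation.FourArmGarbanSquareDomain
import HarnessLib

/-!
# Slit presentation of the domain left after a self-avoiding prefix
(crux `SAWLeftRightFKG.FKGToTraversalBound`, stmt-CriticalPhenomena-1878; line `excursion-domination`, registered
stub `stub_slitPresentation`: sweep lemma ⇒ presentation of the slit domain, incl. the largest-component convention)

`C : c → c` is a closed lattice walk, `Ω = dom C δ = {wind ≠ 0}` its carrier, `π : a → t` a self-avoiding prefix of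
`Ω_δ = discreteDomainGraph Ω δ` started next to a vertex `a'` of `C`, `b` a target joined to `t` off `π ∖ {t}`,
`Keep = {v | some walk v → b of Ω_δ meets π only at t}`.  Everything is proved at mesh `1` (`slitPresentation_one`)
and transported along `CornerLoc.discreteDomainGraph_dom`:
* off-trace unit lattice segments lie in one complementary component of the trace of `C`
  (`CornerLoc.disjoint_segment_range_poly`), so the index is constant on them (`segment_subset_dom_one`);
* sweep `K = meshVertices ∖ Keep` (finite, `CornerLoc.isBounded_dom`): each `k ∈ K` is joined to `C` through
  `K ∪ C.support` by walking east and, if the ray meets `Keep`, back along `π` to `a ∼ a'`; the sweep lemma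
  (hypothesis) gives `C'` with `C'.support = C.support ∪ K` and unchanged index off its trace;
* for `C'`: `meshVertices = Keep`, adjacent `Keep` sites are mesh-adjacent, `Keep` is connected through `b`, so
  `meshDomain = Keep` (`Percolation.meshDomain_eq_meshVertices_of_preconnected`) and the adjacency of `(dom C' 1)_1`
  is that of `Ω_1` restricted to `Keep`.
No named fact is used; axioms are the standard three.
-/

noncomputable section

open Set
open Literature.Probability.LatticeModels Literature.Probability.RandomPlanarGeometry
open Literature.Topology.PlaneTopology
open Summit.CriticalPhenomena.SAWScalingLimit.Theorems.FKGToTraversalBound.Negative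
  (dom notMem_dom_of_mem_support wind_sub_eq_zero_of_mem_range)

namespace Summit.CriticalPhenomena.SAWScalingLimit.Theorems.FKGToTraversalBound.ExcursionDomination

open Summit.CriticalPhenomena.SAWScalingLimit.Theorems.LeftRightFKG.Negative
  (pt meshPoint_one meshPoint_one_eq poly toCurve_pt
    iccExtend_toCurve_apply isChain_support poly_fst_walk wind_eq_zero_of_mem_range)
open Summit.CriticalPhenomena.SAWScalingLimit.Theorems.LeftRightFKG.CornerLoc
  (disjoint_segment_range_poly support_subset_of_walk isBounded_dom discreteDomainGraph_dom)
open Summit.CriticalPhenomena.SAWScalingLimit.Theorems.LeftRightFKG.CornerLoc.StepMono (mem_of_pt_mem_range_poly)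
open Literature.Probability.Percolation (meshDomain_eq_meshVertices_of_preconnected)

/-! ### Graph-theoretic plumbing -/

/-- Transport of a walk along an equality of graphs (support and self-avoidance preserved). [folklore] -/
theorem exists_walk_of_graph_eq {V : Type*} {G₁ G₂ : SimpleGraph V} (h : G₁ = G₂) {u v : V}
    (p : G₁.Walk u v) : ∃ p' : G₂.Walk u v, p'.support = p.support ∧ (p.IsPath → p'.IsPath) := by
  subst h
  exact ⟨p, rfl, id⟩

/-- A walk of `G` inside `S`, all of whose steps are `H`-edges between sites of `S`, joins its endpoints in the
graph induced by `H` on `S`. [folklore] -/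
theorem reachable_induce_of_walk {V : Type*} {G H : SimpleGraph V} {S : Set V}
    (hGH : ∀ ⦃x y : V⦄, x ∈ S → y ∈ S → G.Adj x y → H.Adj x y) :
    ∀ {u v : V} (q : G.Walk u v), (∀ x ∈ q.support, x ∈ S) → ∀ (hu : u ∈ S) (hv : v ∈ S),
      (H.induce S).Reachable ⟨u, hu⟩ ⟨v, hv⟩ := by
  intro u v q
  induction q with
  | nil => intro _ hu hv; exact SimpleGraph.Reachable.refl _
  | @cons u' v' w' h q ih =>
    intro hq hu hv
    have hv' : v' ∈ S :=
      hq v' (by rw [SimpleGraph.Walk.support_cons]; exact List.mem_cons_of_mem _ q.start_mem_support)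
    have hadj : (H.induce S).Adj ⟨u', hu⟩ ⟨v', hv'⟩ := hGH hu hv' h
    exact hadj.reachable.trans (ih (fun x hx => hq x (by
      rw [SimpleGraph.Walk.support_cons]; exact List.mem_cons_of_mem _ hx)) hv' hv)

/-- All vertices of a non-trivial walk of `Ω_δ` are vertices of `Ω_δ`. [folklore] -/
theorem support_subset_meshDomain {Ω : Set ℂ} {δ : ℝ} {u v : Site 2} (w : (discreteDomainGraph Ω δ).Walk u v)
    (huv : u ≠ v) : ∀ z ∈ w.support, z ∈ meshDomain Ω δ := by
  intro z hz
  rcases support_subset_of_walk w z hz with rfl | h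
  · cases w with
    | nil => exact absurd rfl huv
    | cons h _ => exact (discreteDomainGraph_adj_iff.1 h).2.1
  · exact h

/-- A mesh vertex joined by a mesh edge to a vertex of `Ω_δ` lies in the same (largest) component, hence is a
vertex of `Ω_δ`. [folklore] -/
theorem mem_meshDomain_of_adj {Ω : Set ℂ} {δ : ℝ} {x y : Site 2} (hx : x ∈ meshVertices Ω δ)
    (hy : y ∈ meshDomain Ω δ) (h : (meshGraph Ω δ).Adj x y) : x ∈ meshDomain Ω δ := by
  simp only [meshDomain, Set.mem_iUnion, Set.mem_image] at hy ⊢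
  obtain ⟨K, hK, y', hy', rfl⟩ := hy
  refine ⟨K, hK, ⟨x, hx⟩, ?_, rfl⟩
  rw [SimpleGraph.ConnectedComponent.mem_supp_iff] at hy' ⊢
  rw [← hy']
  exact SimpleGraph.ConnectedComponent.connectedComponentMk_eq_of_adj h

/-! ### Lattice geometry of an r2 carrier at mesh `1` -/

/-- A lattice site on the trace of the mesh-`1` curve of a lattice walk is a vertex of the walk. [folklore] -/
theorem mem_support_of_pt_mem_range {u v : Site 2} (w : (zdGraph 2).Walk u v) {x : Site 2}
    (hx : pt x ∈ Set.range (w.toCurve (meshPoint (1 : ℝ)))) : x ∈ w.support := by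
  rw [meshPoint_one_eq, toCurve_pt] at hx
  rw [← w.cons_tail_support]
  exact mem_of_pt_mem_range_poly u _ (isChain_support (fun _ _ h => h) w) hx

/-- Points of the carrier are off the trace of the boundary walk (there the index is the junk `0`). [folklore] -/
theorem notMem_range_of_mem_dom {c : Site 2} (C : (zdGraph 2).Walk c c) (δ : ℝ) {z : ℂ} (hz : z ∈ dom C δ) :
    z ∉ Set.range (C.toCurve (meshPoint δ)) :=
  fun h => hz (wind_sub_eq_zero_of_mem_range h)

/-- Mesh vertices of the carrier are not vertices of the boundary walk. [folklore] -/
theorem notMem_support_of_mem_meshVertices {c : Site 2} (C : (zdGraph 2).Walk c c) (δ : ℝ) {x : Site 2}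
    (hx : x ∈ meshVertices (dom C δ) δ) : x ∉ C.support :=
  fun h => notMem_dom_of_mem_support C δ h hx

/-- **Segments off the trace stay in the carrier.**  A unit lattice segment from a point of `Ω = dom C 1` to a site
that is not a vertex of `C` misses the trace of `C`, so it lies in one complementary component of the trace, where
the index is constant and non-zero: the whole segment lies in `Ω`. [folklore] -/
theorem segment_subset_dom_one {c : Site 2} (C : (zdGraph 2).Walk c c) {x y : Site 2} (hxy : (zdGraph 2).Adj x y)
    (hx : pt x ∈ dom C 1) (hy : y ∉ C.support) : segment ℝ (pt x) (pt y) ⊆ dom C 1 := by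
  have hdom : ∀ q : ℂ, q ∈ dom C 1 ↔ wind (fun t => (poly c C.support.tail).extend t - q) ≠ 0 :=
    fun q => by simp only [dom, Set.mem_setOf_eq, iccExtend_toCurve_apply]
  set PC := poly c C.support.tail with hPC
  have hchain : List.IsChain (zdGraph 2).Adj (c :: C.support.tail) := isChain_support (fun _ _ h => h) C
  have hxT : pt x ∉ range PC := fun h => (hdom _).1 hx (wind_eq_zero_of_mem_range PC h)
  have hyT : pt y ∉ range PC := fun h => hy (by
    have h' := mem_of_pt_mem_range_poly c _ hchain h
    rwa [C.cons_tail_support] at h')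
  have hW : segment ℝ (pt x) (pt y) ⊆ connectedComponentIn (range PC)ᶜ (pt x) :=
    (convex_segment _ _).isPreconnected.subset_connectedComponentIn (left_mem_segment _ _ _)
      (disjoint_segment_range_poly hxy c C.support.tail hchain hxT hyT).subset_compl_right
  have h01 : PC.extend 0 = PC.extend 1 := by rw [Path.extend_zero, Path.extend_one, poly_fst_walk C]
  have hmaps : MapsTo PC.extend (Icc 0 1) (range PC) := fun t ht => by
    rw [Path.extend_apply PC ht]; exact ⟨_, rfl⟩
  intro z hz
  rw [hdom, ← wind_sub_eq_of_mem_connectedComponentIn PC.continuous_extend.continuousOn h01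
    (isCompact_range PC.continuous).isClosed hmaps (hW hz)]
  exact (hdom _).1 hx

/-- A mesh vertex of the carrier and a lattice neighbour off the boundary walk are joined in the mesh graph.
[folklore] -/
theorem meshGraph_adj_of_adj {c : Site 2} (C : (zdGraph 2).Walk c c) {x y : Site 2} (hxy : (zdGraph 2).Adj x y)
    (hx : x ∈ meshVertices (dom C 1) 1) (hy : y ∉ C.support) : (meshGraph (dom C 1) 1).Adj x y := by
  rw [mem_meshVertices_iff, meshPoint_one] at hx
  refine meshGraph_adj_iff.2 ⟨hxy, ?_⟩
  rw [meshPoint_one, meshPoint_one]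
  exact (segment_subset_dom_one C hxy hx hy).trans subset_closure

/-! ### The slit presentation at mesh `1` -/

/-- **Slit presentation at mesh `1`.**  Given the sweep lemma, the domain left after a self-avoiding prefix
`π : a → t` of `Ω_1`, `Ω = dom C 1`, started next to the boundary walk — `Ω_1` restricted to the sites joined to `b`
off `π ∖ {t}` — is the discrete domain of the swept walk `C'`, whose support contains `C.support` and `π ∖ {t}`.
[folklore] -/
theorem slitPresentation_one
    (hsweep : ∀ (c : Site 2) (C : (zdGraph 2).Walk c c) (K : Finset (Site 2)),
      (∀ k ∈ K, ∃ (q : Site 2) (p : (zdGraph 2).Walk k q), q ∈ C.support ∧ ∀ x ∈ p.support, x ∈ K ∨ x ∈ C.support) →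
      ∃ C' : (zdGraph 2).Walk c c, (∀ x : Site 2, x ∈ C'.support ↔ (x ∈ C.support ∨ x ∈ K)) ∧
        ∀ (δ : ℝ) (z : ℂ), 0 < δ → z ∉ Set.range (C'.toCurve (meshPoint δ)) →
          z ∉ Set.range (C.toCurve (meshPoint δ)) ∧
          wind (fun s : ℝ => Set.IccExtend zero_le_one (C'.toCurve (meshPoint δ)) s - z) =
            wind (fun s : ℝ => Set.IccExtend zero_le_one (C.toCurve (meshPoint δ)) s - z))
    {c a a' t b : Site 2} (C : (zdGraph 2).Walk c c) (π : (discreteDomainGraph (dom C 1) 1).Walk a t)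
    (ha' : a' ∈ C.support) (haa' : (zdGraph 2).Adj a a') (hπ : π.IsPath) (hat : a ≠ t)
    (hq : ∃ q : (discreteDomainGraph (dom C 1) 1).Walk t b, ∀ x ∈ q.support, x ∈ π.support → x = t) :
    ∃ C' : (zdGraph 2).Walk c c, (∀ x ∈ C.support, x ∈ C'.support) ∧ (∀ v ∈ π.support, v ≠ t → v ∈ C'.support) ∧
      ∀ x y : Site 2, (discreteDomainGraph (dom C' 1) 1).Adj x y ↔
        ((discreteDomainGraph (dom C 1) 1).Adj x y ∧
          (∃ q : (discreteDomainGraph (dom C 1) 1).Walk x b, ∀ v ∈ q.support, v ∈ π.support → v = t) ∧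
          (∃ q : (discreteDomainGraph (dom C 1) 1).Walk y b, ∀ v ∈ q.support, v ∈ π.support → v = t)) := by
  classical
  obtain ⟨q₀, hq₀⟩ := hq
  -- the set `Keep` of sites joined to `b` off `π ∖ {t}`
  obtain ⟨Keep, hKeep⟩ : ∃ Keep : Set (Site 2), ∀ v, v ∈ Keep ↔
      ∃ q : (discreteDomainGraph (dom C 1) 1).Walk v b, ∀ x ∈ q.support, x ∈ π.support → x = t :=
    ⟨{v | ∃ q : (discreteDomainGraph (dom C 1) 1).Walk v b, ∀ x ∈ q.support, x ∈ π.support → x = t},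
      fun v => Iff.rfl⟩
  have hGle : discreteDomainGraph (dom C 1) 1 ≤ zdGraph 2 :=
    (discreteDomainGraph_le_meshGraph _ _).trans (meshGraph_le_zdGraph _ _)
  -- bookkeeping: `π ∖ {t}`, `t`, `b`, `Keep` lie in `Ω_1`
  have hπD : ∀ v ∈ π.support, v ∈ meshDomain (dom C 1) 1 := support_subset_meshDomain π hat
  have htD : t ∈ meshDomain (dom C 1) 1 := hπD t π.end_mem_support
  have hbD : b ∈ meshDomain (dom C 1) 1 := (support_subset_of_walk q₀ b q₀.end_mem_support).elim (· ▸ htD) id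
  have hbKeep : b ∈ Keep := by
    refine (hKeep b).2 ⟨SimpleGraph.Walk.nil, fun x hx hxπ => ?_⟩
    rw [SimpleGraph.Walk.support_nil, List.mem_singleton] at hx
    subst hx
    exact hq₀ _ q₀.end_mem_support hxπ
  have hKeepD : ∀ v ∈ Keep, v ∈ meshDomain (dom C 1) 1 := fun v hv => ((hKeep v).1 hv).elim fun q _ =>
    (support_subset_of_walk q.reverse v q.reverse.end_mem_support).elim (· ▸ hbD) id
  have hKeepV : ∀ v ∈ Keep, v ∈ meshVertices (dom C 1) 1 :=
    fun v hv => meshDomain_subset_meshVertices _ _ (hKeepD v hv)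
  have hKeep_notC : ∀ v ∈ Keep, v ∉ C.support := fun v hv => notMem_support_of_mem_meshVertices C 1 (hKeepV v hv)
  have hKeep_of_walk : ∀ (v : Site 2) (q : (discreteDomainGraph (dom C 1) 1).Walk v b),
      (∀ x ∈ q.support, x ∈ π.support → x = t) → ∀ x ∈ q.support, x ∈ Keep := fun v q hq x hx =>
    (hKeep x).2 ⟨q.dropUntil x hx, fun y hy => hq y (q.support_dropUntil_subset_support hx hy)⟩
  -- a mesh vertex off `π ∖ {t}` next to a `Keep` site is a `Keep` site
  have hKeep_adj : ∀ u w : Site 2, w ∈ Keep → u ∈ meshVertices (dom C 1) 1 → (zdGraph 2).Adj u w →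
      (u ∈ π.support → u = t) → u ∈ Keep := by
    intro u w hw hu huw huπ
    obtain ⟨q, hq⟩ := (hKeep w).1 hw
    have hmesh : (meshGraph (dom C 1) 1).Adj u w := meshGraph_adj_of_adj C huw hu (hKeep_notC w hw)
    have huD := mem_meshDomain_of_adj hu (hKeepD w hw) hmesh
    refine (hKeep u).2 ⟨SimpleGraph.Walk.cons (discreteDomainGraph_adj_iff.2 ⟨hmesh, huD, hKeepD w hw⟩) q, ?_⟩
    intro x hx hxπ
    rw [SimpleGraph.Walk.support_cons, List.mem_cons] at hx
    rcases hx with rfl | hx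
    · exact huπ hxπ
    · exact hq x hx hxπ
  -- the sweep set `K = meshVertices ∖ Keep`; it contains `π ∖ {t}`
  have hbdd : Bornology.IsBounded (dom C 1) := isBounded_dom C 1
  have hVfin : (meshVertices (dom C 1) 1).Finite := meshVertices_finite hbdd one_pos
  set K : Finset (Site 2) := hVfin.toFinset.filter (fun v => v ∉ Keep) with hKdef
  have hKmem : ∀ k, k ∈ K ↔ k ∈ meshVertices (dom C 1) 1 ∧ k ∉ Keep := fun k => by
    rw [hKdef, Finset.mem_filter, Set.Finite.mem_toFinset]
  have hPK : ∀ v ∈ π.support, v ≠ t → v ∈ K := fun v hv hvt =>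
    (hKmem v).2 ⟨meshDomain_subset_meshVertices _ _ (hπD v hv), fun h => by
      obtain ⟨q, hq⟩ := (hKeep v).1 h
      exact hvt (hq v q.start_mem_support hv)⟩
  -- every site of `K` is joined to a vertex of `C` through `K ∪ C.support` (walk east)
  obtain ⟨m, -, hm⟩ := Set.exists_max_image _ (fun x : Site 2 => x 0) hVfin ⟨t, meshDomain_subset_meshVertices _ _ htD⟩
  set e₀ : Site 2 := Pi.single 0 1 with he₀
  have hadjE : ∀ k : Site 2, (zdGraph 2).Adj k (k + e₀) := fun k => (zdGraph_adj_iff _ _).2 ⟨0, Or.inl rfl⟩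
  have he0 : ∀ k : Site 2, (k + e₀) 0 = k 0 + 1 := fun k => by simp [he₀]
  have base : ∀ k, k ∈ K → k + e₀ ∉ K →
      ∃ (q : Site 2) (p : (zdGraph 2).Walk k q), q ∈ C.support ∧ ∀ x ∈ p.support, x ∈ K ∨ x ∈ C.support := by
    intro k hk hk'
    obtain ⟨hkV, hkKeep⟩ := (hKmem k).1 hk
    by_cases hk'C : k + e₀ ∈ C.support
    · refine ⟨k + e₀, SimpleGraph.Walk.cons (hadjE k) SimpleGraph.Walk.nil, hk'C, fun x hx => ?_⟩
      rw [SimpleGraph.Walk.support_cons, SimpleGraph.Walk.support_nil, List.mem_cons, List.mem_singleton] at hx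
      rcases hx with rfl | rfl
      · exact Or.inl hk
      · exact Or.inr hk'C
    · have hk'Keep : k + e₀ ∈ Keep := by
        by_contra h
        refine hk' ((hKmem _).2 ⟨?_, h⟩)
        rw [mem_meshVertices_iff, meshPoint_one] at hkV ⊢
        exact segment_subset_dom_one C (hadjE k) hkV hk'C (right_mem_segment _ _ _)
      have hkπ : k ∈ π.support ∧ k ≠ t := by
        by_contra hcon
        refine hkKeep (hKeep_adj k (k + e₀) hk'Keep hkV (hadjE k) fun hkπ => ?_)
        by_contra hkt
        exact hcon ⟨hkπ, hkt⟩
      have hsub : ∀ x ∈ (π.takeUntil k hkπ.1).support, x ∈ K := by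
        intro x hx
        refine hPK x (π.support_takeUntil_subset_support hkπ.1 hx) fun hxt => ?_
        subst hxt
        exact SimpleGraph.Walk.endpoint_notMem_support_takeUntil hπ hkπ.1 hkπ.2.symm hx
      refine ⟨a', ((π.takeUntil k hkπ.1).reverse.mapLe hGle).concat haa', ha', fun x hx => ?_⟩
      simp only [SimpleGraph.Walk.support_concat, List.mem_append, List.mem_singleton,
        SimpleGraph.Walk.support_mapLe_eq_support, SimpleGraph.Walk.support_reverse, List.mem_reverse] at hx
      rcases hx with hx | rfl
      · exact Or.inl (hsub x hx)
      · exact Or.inr ha'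
  have key : ∀ n : ℕ, ∀ k, k ∈ K → m 0 - k 0 ≤ n →
      ∃ (q : Site 2) (p : (zdGraph 2).Walk k q), q ∈ C.support ∧ ∀ x ∈ p.support, x ∈ K ∨ x ∈ C.support := by
    intro n
    induction n with
    | zero =>
      intro k hk hn
      refine base k hk fun hk' => ?_
      have h1 := hm _ ((hKmem _).1 hk').1
      rw [he0] at h1; push_cast at hn; omega
    | succ n ih =>
      intro k hk hn
      by_cases hk' : k + e₀ ∈ K
      · obtain ⟨q, p, hqC, hp⟩ := ih _ hk' (by rw [he0]; push_cast at hn ⊢; omega)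
        refine ⟨q, SimpleGraph.Walk.cons (hadjE k) p, hqC, fun x hx => ?_⟩
        rw [SimpleGraph.Walk.support_cons, List.mem_cons] at hx
        rcases hx with rfl | hx
        · exact Or.inl hk
        · exact hp x hx
      · exact base k hk hk'
  -- sweep
  obtain ⟨C', hC'supp, hC'wind⟩ := hsweep c C K fun k hk => key (m 0 - k 0).toNat k hk (Int.self_le_toNat _)
  have hKeep_notC' : ∀ x ∈ Keep, x ∉ C'.support := fun x hx h =>
    ((hC'supp x).1 h).elim (hKeep_notC x hx) (fun hK => ((hKmem x).1 hK).2 hx)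
  -- the new mesh vertices are `Keep` (the index is unchanged off the new trace)
  have hV' : ∀ x, x ∈ meshVertices (dom C' 1) 1 ↔ x ∈ Keep := by
    intro x
    rw [mem_meshVertices_iff, meshPoint_one]
    constructor
    · intro hx
      have hxT' : pt x ∉ Set.range (C'.toCurve (meshPoint 1)) := notMem_range_of_mem_dom C' 1 hx
      obtain ⟨-, hw⟩ := hC'wind 1 (pt x) one_pos hxT'
      have hxV : x ∈ meshVertices (dom C 1) 1 := by
        rw [mem_meshVertices_iff, meshPoint_one]; change wind _ ≠ 0; rw [← hw]; exact hx
      have hxC' : x ∉ C'.support := fun h => hxT' (by simpa only [meshPoint_one] using C'.mem_range_toCurve (meshPoint 1) h)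
      by_contra hxK
      exact hxC' ((hC'supp x).2 (Or.inr ((hKmem x).2 ⟨hxV, hxK⟩)))
    · intro hx
      have hxV : pt x ∈ dom C 1 := by
        have h := hKeepV x hx
        rwa [mem_meshVertices_iff, meshPoint_one] at h
      obtain ⟨-, hw⟩ := hC'wind 1 (pt x) one_pos fun h => hKeep_notC' x hx (mem_support_of_pt_mem_range C' h)
      change wind _ ≠ 0; rw [hw]; exact hxV
  -- adjacent `Keep` sites are joined in the new mesh graph
  have hmesh' : ∀ x y, x ∈ Keep → y ∈ Keep → (zdGraph 2).Adj x y → (meshGraph (dom C' 1) 1).Adj x y :=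
    fun x y hx hy hxy => meshGraph_adj_of_adj C' hxy ((hV' x).2 hx) (hKeep_notC' y hy)
  -- the new mesh-vertex graph is preconnected (through `b`), so the new discrete domain is `Keep`
  have hpre : (meshVertexGraph (dom C' 1) 1).Preconnected := by
    have hreach : ∀ u : meshVertices (dom C' 1) 1,
        (meshVertexGraph (dom C' 1) 1).Reachable u ⟨b, (hV' b).2 hbKeep⟩ := by
      rintro ⟨u, hu⟩
      obtain ⟨q, hq⟩ := (hKeep u).1 ((hV' u).1 hu)
      exact reachable_induce_of_walk (G := discreteDomainGraph (dom C 1) 1) (H := meshGraph (dom C' 1) 1)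
        (S := meshVertices (dom C' 1) 1) (fun x y hx hy hxy => hmesh' x y ((hV' x).1 hx) ((hV' y).1 hy) (hGle hxy))
        q (fun x hx => (hV' x).2 (hKeep_of_walk u q hq x hx)) hu _
    exact fun u v => (hreach u).trans (hreach v).symm
  -- conclusion
  refine ⟨C', fun x hx => (hC'supp x).2 (Or.inl hx), fun v hv hvt => (hC'supp v).2 (Or.inr (hPK v hv hvt)),
    fun x y => ?_⟩
  rw [discreteDomainGraph_adj_iff, meshDomain_eq_meshVertices_of_preconnected hpre, hV', hV']
  constructor
  · rintro ⟨hm', hx, hy⟩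
    exact ⟨discreteDomainGraph_adj_iff.2 ⟨meshGraph_adj_of_adj C (meshGraph_le_zdGraph _ _ hm') (hKeepV x hx)
      (hKeep_notC y hy), hKeepD x hx, hKeepD y hy⟩, (hKeep x).1 hx, (hKeep y).1 hy⟩
  · rintro ⟨hG', hx, hy⟩
    exact ⟨hmesh' x y ((hKeep x).2 hx) ((hKeep y).2 hy) (hGle hG'), (hKeep x).2 hx, (hKeep y).2 hy⟩

/-! ### The registered stub -/

/-- **Registered stub `stub_slitPresentation`** (line `excursion-domination`, crux stmt-CriticalPhenomena-1878): the
sweep lemma implies the slit presentation — after a self-avoiding prefix `π : a → t` of `Ω_δ`, `Ω = dom C δ`, started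
next to the boundary walk `C`, the graph `Ω_δ` restricted to the sites joined to `b` off `π ∖ {t}` is the discrete
domain `(dom C' δ)_δ` of a closed lattice walk `C'` through `C.support` and `π ∖ {t}` (so `LeftRightFKG` is again
instantiable from the tip `t`).  Reduced to mesh `1` (`CornerLoc.discreteDomainGraph_dom`, `slitPresentation_one`).
[folklore] -/
theorem stub_slitPresentation :
    (∀ (c : Site 2) (C : (zdGraph 2).Walk c c) (K : Finset (Site 2)),
      (∀ k ∈ K, ∃ (q : Site 2) (p : (zdGraph 2).Walk k q), q ∈ C.support ∧
        ∀ x ∈ p.support, x ∈ K ∨ x ∈ C.support) →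
      ∃ C' : (zdGraph 2).Walk c c,
        (∀ x : Site 2, x ∈ C'.support ↔ (x ∈ C.support ∨ x ∈ K)) ∧
        ∀ (δ : ℝ) (z : ℂ), 0 < δ → z ∉ Set.range (C'.toCurve (meshPoint δ)) →
          z ∉ Set.range (C.toCurve (meshPoint δ)) ∧
          Literature.Topology.PlaneTopology.wind
              (fun s : ℝ => Set.IccExtend zero_le_one (C'.toCurve (meshPoint δ)) s - z) =
            Literature.Topology.PlaneTopology.wind
              (fun s : ℝ => Set.IccExtend zero_le_one (C.toCurve (meshPoint δ)) s - z)) →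
    ∀ (δ : ℝ) (c a a' t b : Site 2) (C : (zdGraph 2).Walk c c)
      (π : (discreteDomainGraph (dom C δ) δ).Walk a t),
      0 < δ → a' ∈ C.support → (zdGraph 2).Adj a a' → π.IsPath → a ≠ t →
      (∃ q : (discreteDomainGraph (dom C δ) δ).Walk t b, ∀ x ∈ q.support, x ∈ π.support → x = t) →
      ∃ (c' : Site 2) (C' : (zdGraph 2).Walk c' c'),
        (∀ x ∈ C.support, x ∈ C'.support) ∧ (∀ v ∈ π.support, v ≠ t → v ∈ C'.support) ∧
        ∀ x y : Site 2, (discreteDomainGraph (dom C' δ) δ).Adj x y ↔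
          ((discreteDomainGraph (dom C δ) δ).Adj x y ∧
            (∃ q : (discreteDomainGraph (dom C δ) δ).Walk x b, ∀ v ∈ q.support, v ∈ π.support → v = t) ∧
            (∃ q : (discreteDomainGraph (dom C δ) δ).Walk y b,
              ∀ v ∈ q.support, v ∈ π.support → v = t)) := by
  intro hsweep δ c a a' t b C π hδ ha' haa' hπ hat hq
  have hG : discreteDomainGraph (dom C δ) δ = discreteDomainGraph (dom C 1) 1 := discreteDomainGraph_dom C hδ.ne'
  obtain ⟨π₁, hπ₁s, hπ₁p⟩ := exists_walk_of_graph_eq hG π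
  have hex : ∀ (σ : List (Site 2)) (z : Site 2),
      (∃ q : (discreteDomainGraph (dom C δ) δ).Walk z b, ∀ v ∈ q.support, v ∈ σ → v = t) ↔
        ∃ q : (discreteDomainGraph (dom C 1) 1).Walk z b, ∀ v ∈ q.support, v ∈ σ → v = t := by
    intro σ z
    exact ⟨fun ⟨q, hq⟩ => (exists_walk_of_graph_eq hG q).elim fun q' h => ⟨q', fun v hv => hq v (h.1 ▸ hv)⟩,
      fun ⟨q, hq⟩ => (exists_walk_of_graph_eq hG.symm q).elim fun q' h => ⟨q', fun v hv => hq v (h.1 ▸ hv)⟩⟩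
  have hq₁ : ∃ q : (discreteDomainGraph (dom C 1) 1).Walk t b, ∀ x ∈ q.support, x ∈ π₁.support → x = t := by
    rw [hπ₁s]; exact (hex π.support t).1 hq
  obtain ⟨C', h1, h2, h3⟩ := slitPresentation_one hsweep C π₁ ha' haa' (hπ₁p hπ) hat hq₁
  refine ⟨c, C', h1, fun v hv hvt => h2 v (by rw [hπ₁s]; exact hv) hvt, fun x y => ?_⟩
  rw [show discreteDomainGraph (dom C' δ) δ = discreteDomainGraph (dom C' 1) 1 from discreteDomainGraph_dom C' hδ.ne',
    h3, ← hπ₁s, hex, hex, hG]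

end Summit.CriticalPhenomena.SAWScalingLimit.Theorems.FKGToTraversalBound.ExcursionDomination

end
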